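import Mathlib
import Literature.Computability.AlgebraicComplexity.PermanentIrreducible
import Literature.Computability.AlgebraicComplexity.StandardFamiliesProofs
import Literature.Computability.AlgebraicComplexity.ArithCircuitProofs
import Summits.ValiantsHypothesis.ValiantsHypothesis.Theorems.DivisionGapPerCofactorDegreeReductionWindowGlue
import Summits.ValiantsHypothesis.ValiantsHypothesis.Theorems.DivisionGapPerCofactorDegreeReductionStubTwoSignedClassesExist
import Summits.ValiantsHypothesis.ValiantsHypothesis.Theorems.DivisionGapPerCofactorDegreeReductionStubParametrizedRelations
import Summits.ValiantsHypothesis.ValiantsHypothesis.Theorems.DivisionGapPerCofactorDegreeReductionStubParametrizedConicGap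
import Summits.ValiantsHypothesis.ValiantsHypothesis.Theorems.DivisionGapPerCofactorDegreeReductionStubConicCheapRelation

/-!
# Crux `DivisionGap.PerCofactorDegreeReduction` (stmt-ValiantsHypothesis-15046), line `Sketch` — the
# positivity gap of relation curves modulo the permanent is UNBOUNDED (Q1 of cycle 6 answered in the negative)

Line lead c6 (cycle 7), sorry-free composition of the cycle-7 stubs `stub_twoSignedClassesExist`,
`stub_parametrizedRelations`, `stub_parametrizedConicGap`, `stub_conicCheapRelation` (all landed).

**Theorem (`positivityGap_unbounded`).**  For every `n ≥ 2` and every `k` there are three NONNEGATIVE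
polynomials `u₀, u₁, u₂ ∈ ℝ≥0[x_ij]` (`n × n` variables), nonzero, of total degree `≤ 2(n+1)` — the same for
every `k` up to one real coefficient — such that
* (i) some nonzero `G ∈ ℝ≥0[z₀,z₁,z₂]` of total degree `≤ 2^{k+1}` and circuit complexity `≤ 2(k+3)²` has
  `G(u) ≠ 0` and `per_n ∣ G(u)` over `ℝ` (a cheap, high-degree nonnegative member of the ideal `(per_n)`
  manufactured from the three "light gates" `u`), while
* (ii) EVERY nonzero `G ∈ ℝ≥0[z₀,z₁,z₂]` with `per_n ∣ G(u)` over `ℝ` has total degree `≥ 2^k`.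

So "positive-relation degree reduction over given light gates" (from a nonnegative relation of the gates of
huge degree, infer one of quasi-polynomial degree) fails for the permanent itself, at fixed degree and cost
of the gates: a proof of the creation-degree statement K1 of the line must manufacture NEW light gates.

## Construction and proof

Split `per_n = per⁺ + per⁻` by the sign of the permutation and fix two cells `a ≠ b`.  The classes of
`V₁ = x_a per⁺` and `V₂ = x_b per⁺` modulo `per_n` are TWO-SIGNED (`Vᵢ ≡ −Vᵢ'` with `V₁' = x_a per⁻`,
`V₂' = x_b per⁻`, since `Vᵢ + Vᵢ' = x · per_n`) and algebraically independent (`stub_twoSignedClassesExist`).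
With `θ = π/2^{k+1}` (so `0 ≤ 2cos θ`) put
`u₀ = V₁² + V₁V₂`, `u₁ = V₁V₂ + V₂²`, `u₂ = V₁V₁' + (2cos θ)V₁V₂ + V₂V₂'`.
Over `ℝ`, with `A, B` the images of `V₁, V₂`: `u₀ = A(A+B)`, `u₁ = B(A+B)` and
`u₂ ≡ −(A² − 2cos θ·AB + B²)` modulo `per_n` (the difference is `A(A+A') + B(B+B') = (x_a² + x_b²) per⁺ · per_n`),
i.e. the gates are the parametrisation `P = (y₀(y₀+y₁), y₁(y₀+y₁), −(y₀² − 2cos θ y₀y₁ + y₁²))` of the conic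
`z₀² − 2cos θ z₀z₁ + z₁² + z₂(z₀+z₁)` evaluated at the independent classes `A, B`.  Hence
(`stub_parametrizedRelations`) `per_n ∣ G(u)` iff `G(P) = 0` in `ℝ[y₀,y₁]`; `stub_conicCheapRelation` supplies a
nonnegative `G` of degree `2^{k+1}` and cost `≤ 2(k+3)²` with `G(P) = 0`, and `stub_parametrizedConicGap` shows
that every nonzero nonnegative `G` with `G(P) = 0` has `deg G · θ ≥ π/2`, i.e. `deg G ≥ 2^k`.  Nonvanishing of
`G(u)` for nonzero `G`: over `ℝ≥0` there is no cancellation (evaluate at the all-ones point).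
-/

noncomputable section

-- `Summit.ValiantsHypothesis.ValiantsHypothesis.…` is the tree's mandated single-conjunct layout
-- (Problem = Summit), so the duplicated namespace component is intended.
set_option linter.dupNamespace false

namespace Summit.ValiantsHypothesis.ValiantsHypothesis.Theorems.DivisionGap.PerCofactorDegreeReduction.GapCorollaries

open MvPolynomial Literature.Computability.AlgebraicComplexity
open Summit.ValiantsHypothesis.ValiantsHypothesis.Theorems.DivisionGap.PerCofactorDegreeReduction
open scoped NNReal BigOperators

/-- Over `ℝ≥0` a nonzero polynomial is positive at every positive point (no cancellation). [folklore] -/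
theorem eval_pos_of_ne_zero {σ : Type*} (f : MvPolynomial σ ℝ≥0) (hf : f ≠ 0)
    (x : σ → ℝ≥0) (hx : ∀ i, 0 < x i) : 0 < MvPolynomial.eval x f := by
  classical
  obtain ⟨d, hd⟩ := support_nonempty.mpr hf
  rw [eval_eq]
  refine lt_of_lt_of_le ?_ (Finset.single_le_sum (fun _ _ => zero_le) hd)
  refine mul_pos (pos_iff_ne_zero.mpr (mem_support_iff.mp hd)) ?_
  exact Finset.prod_pos fun i _ => pow_pos (hx i) _

/-- Over `ℝ≥0`, substituting nonzero polynomials into a nonzero polynomial gives a nonzero polynomial. [folklore] -/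
theorem aeval_ne_zero_of_ne_zero {σ τ : Type*} (u : τ → MvPolynomial σ ℝ≥0) (hu : ∀ j, u j ≠ 0)
    (G : MvPolynomial τ ℝ≥0) (hG : G ≠ 0) : MvPolynomial.aeval u G ≠ 0 := by
  classical
  intro h
  set e : MvPolynomial σ ℝ≥0 →+* ℝ≥0 := MvPolynomial.eval (fun _ => (1 : ℝ≥0)) with he
  have hcomp : e.comp (algebraMap ℝ≥0 (MvPolynomial σ ℝ≥0)) = RingHom.id _ :=
    RingHom.ext fun r => by simp [he]
  have h1 : e (MvPolynomial.aeval u G) = MvPolynomial.eval (fun j => e (u j)) G := by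
    rw [MvPolynomial.aeval_def, MvPolynomial.eval₂_comp_left, hcomp]
    rfl
  have hpos : 0 < MvPolynomial.eval (fun j => e (u j)) G :=
    eval_pos_of_ne_zero G hG _ fun j => eval_pos_of_ne_zero (u j) (hu j) _ fun _ => one_pos
  rw [← h1, h, map_zero] at hpos
  exact lt_irrefl _ hpos

/-- Over `ℝ≥0`, `p + q = 0` forces `p = 0` (no cancellation). [folklore] -/
theorem add_ne_zero_of_left_ne_zero {σ : Type*} {p : MvPolynomial σ ℝ≥0} (q : MvPolynomial σ ℝ≥0)
    (hp : p ≠ 0) : p + q ≠ 0 := by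
  intro h
  apply hp
  refine MvPolynomial.ext _ _ fun m => ?_
  have hm := congr_arg (coeff m) h
  rw [coeff_add, coeff_zero] at hm
  rw [coeff_zero]
  exact (add_eq_zero.mp hm).1

/-- **Q1 answered (c6): THE POSITIVITY GAP OF RELATION CURVES MODULO `per_n` IS
UNBOUNDED at fixed degree and cost.**  For every `n ≥ 2` and `k` there are nonnegative light gates `u₀, u₁, u₂` of
degree `≤ 2(n+1)`, nonzero (built on the two-signed classes `x_a per⁺`, `x_b per⁺`: `u₀ = V₁² + V₁V₂`,
`u₁ = V₁V₂ + V₂²`, `u₂ = V₁V₁' + 2cos θ·V₁V₂ + V₂V₂'`, `θ = π/2^{k+1}`), such that (i) some nonzero nonnegative `G` of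
`z`-degree `≤ 2^{k+1}` and cost `≤ 2(k+3)²` gives a NONZERO element `G(u) ∈ (per_n)`, and (ii) EVERY nonzero
nonnegative `G` with `G(u) ∈ (per_n)` has `z`-degree `≥ 2^k`.  Neither the gates nor their cost depend on `k`: positive
relation degree reduction over given light gates fails for the permanent itself. -/
theorem positivityGap_unbounded (n k : ℕ) (hn : 2 ≤ n) :
    ∃ u : Fin 3 → MvPolynomial (Fin n × Fin n) ℝ≥0,
      (∀ j, (u j).totalDegree ≤ 2 * (n + 1)) ∧ (∀ j, u j ≠ 0) ∧
      (∃ G : MvPolynomial (Fin 3) ℝ≥0, G ≠ 0 ∧ G.totalDegree ≤ 2 ^ (k + 1) ∧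
        complexity G ≤ 2 * (k + 3) ^ 2 ∧ MvPolynomial.aeval u G ≠ 0 ∧
        perPoly (Fin n) ℝ ∣ MvPolynomial.map NNReal.toRealHom (MvPolynomial.aeval u G)) ∧
      (∀ G : MvPolynomial (Fin 3) ℝ≥0, G ≠ 0 →
        perPoly (Fin n) ℝ ∣ MvPolynomial.map NNReal.toRealHom (MvPolynomial.aeval u G) →
        2 ^ k ≤ G.totalDegree) := by
  classical
  have h0 : 0 < n := by omega
  have h1 : 1 < n := by omega
  -- two distinct cells
  set a : Fin n × Fin n := (⟨0, h0⟩, ⟨0, h0⟩) with ha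
  set b : Fin n × Fin n := (⟨0, h0⟩, ⟨1, h1⟩) with hb
  have hab : a ≠ b := by
    simp only [ha, hb, Ne, Prod.mk.injEq, Fin.mk.injEq, true_and]
    omega
  -- the parity halves of the permanent over `ℝ≥0`
  set Pp : MvPolynomial (Fin n × Fin n) ℝ≥0 := ∑ σ ∈ (Finset.univ : Finset (Equiv.Perm (Fin n))).filter
      (fun σ => Equiv.Perm.sign σ = 1), monomial (permMonomial σ) 1 with hPp
  set Pm : MvPolynomial (Fin n × Fin n) ℝ≥0 := ∑ σ ∈ (Finset.univ : Finset (Equiv.Perm (Fin n))).filter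
      (fun σ => Equiv.Perm.sign σ = -1), monomial (permMonomial σ) 1 with hPm
  obtain ⟨hsum, hPp0, hPm0, hdegp, hdegm, -, -, hind⟩ :=
    TwoSignedClassesExist.stub_twoSignedClassesExist n hn a b hab Pp Pm rfl rfl
  -- the angle
  set θ : ℝ := Real.pi / 2 ^ (k + 1) with hθdef
  have hpow0 : (0 : ℝ) < 2 ^ (k + 1) := by positivity
  have hθ : 0 < θ := div_pos Real.pi_pos hpow0
  have hθπ : θ < Real.pi := by
    rw [hθdef, div_lt_iff₀ hpow0]
    have hpow : (1 : ℝ) < 2 ^ (k + 1) := one_lt_pow₀ (by norm_num) (by omega)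
    nlinarith [Real.pi_pos]
  have hθle : θ ≤ Real.pi / 2 := by
    rw [hθdef]
    refine div_le_div_of_nonneg_left Real.pi_pos.le (by norm_num) ?_
    calc (2 : ℝ) = 2 ^ 1 := by norm_num
      _ ≤ 2 ^ (k + 1) := pow_le_pow_right₀ (by norm_num) (by omega)
  have hcos : 0 ≤ Real.cos θ := Real.cos_nonneg_of_mem_Icc ⟨by linarith, hθle⟩
  set cN : ℝ≥0 := ⟨2 * Real.cos θ, by positivity⟩ with hcNdef
  have hcN : (NNReal.toRealHom cN : ℝ) = 2 * Real.cos θ := rfl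
  -- the four generators and the three gates
  set V₁ : MvPolynomial (Fin n × Fin n) ℝ≥0 := X a * Pp with hV₁
  set V₁' : MvPolynomial (Fin n × Fin n) ℝ≥0 := X a * Pm with hV₁'
  set V₂ : MvPolynomial (Fin n × Fin n) ℝ≥0 := X b * Pp with hV₂
  set V₂' : MvPolynomial (Fin n × Fin n) ℝ≥0 := X b * Pm with hV₂'
  set u : Fin 3 → MvPolynomial (Fin n × Fin n) ℝ≥0 :=
    ![V₁ ^ 2 + V₁ * V₂, V₁ * V₂ + V₂ ^ 2, V₁ * V₁' + cN • (V₁ * V₂) + V₂ * V₂'] with hu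
  have hu0' : u 0 = V₁ ^ 2 + V₁ * V₂ := rfl
  have hu1' : u 1 = V₁ * V₂ + V₂ ^ 2 := rfl
  have hu2' : u 2 = V₁ * V₁' + cN • (V₁ * V₂) + V₂ * V₂' := rfl
  -- real images
  set P' : MvPolynomial (Fin n × Fin n) ℝ := MvPolynomial.map NNReal.toRealHom Pp with hP'
  set M' : MvPolynomial (Fin n × Fin n) ℝ := MvPolynomial.map NNReal.toRealHom Pm with hM'
  set A : MvPolynomial (Fin n × Fin n) ℝ := X a * P' with hA
  set B : MvPolynomial (Fin n × Fin n) ℝ := X b * P' with hB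
  have hper : P' + M' = perPoly (Fin n) ℝ := by
    rw [hP', hM', ← map_add, hsum, map_perPoly]
  set P : Fin 3 → MvPolynomial (Fin 2) ℝ :=
    ![X 0 * (X 0 + X 1), X 1 * (X 0 + X 1), -(X 0 ^ 2 - C (2 * Real.cos θ) * X 0 * X 1 + X 1 ^ 2)] with hPdef
  have hP0' : P 0 = X 0 * (X 0 + X 1) := rfl
  have hP1' : P 1 = X 1 * (X 0 + X 1) := rfl
  have hP2' : P 2 = -(X 0 ^ 2 - C (2 * Real.cos θ) * X 0 * X 1 + X 1 ^ 2) := rfl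
  set U : Fin 3 → MvPolynomial (Fin n × Fin n) ℝ := fun j => MvPolynomial.map NNReal.toRealHom (u j) with hUdef
  have hmapV₁ : MvPolynomial.map NNReal.toRealHom V₁ = A := by rw [hV₁, map_mul, map_X]
  have hmapV₂ : MvPolynomial.map NNReal.toRealHom V₂ = B := by rw [hV₂, map_mul, map_X]
  have hmapV₁' : MvPolynomial.map NNReal.toRealHom V₁' = X a * M' := by rw [hV₁', map_mul, map_X]
  have hmapV₂' : MvPolynomial.map NNReal.toRealHom V₂' = X b * M' := by rw [hV₂', map_mul, map_X]
  have hU0 : U 0 = A ^ 2 + A * B := by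
    show MvPolynomial.map NNReal.toRealHom (u 0) = _
    simp only [hu0', map_add, map_pow, map_mul, hmapV₁, hmapV₂]
  have hU1 : U 1 = A * B + B ^ 2 := by
    show MvPolynomial.map NNReal.toRealHom (u 1) = _
    simp only [hu1', map_add, map_pow, map_mul, hmapV₁, hmapV₂]
  have hU2 : U 2 = A * (X a * M') + C (2 * Real.cos θ) * (A * B) + B * (X b * M') := by
    show MvPolynomial.map NNReal.toRealHom (u 2) = _
    simp only [hu2', map_add, map_mul, MvPolynomial.smul_eq_C_mul, map_C, hmapV₁, hmapV₂, hmapV₁', hmapV₂',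
      hcN]
  have hAB : ∀ q : MvPolynomial (Fin 2) ℝ, MvPolynomial.aeval ![A, B] q =
      MvPolynomial.eval₂ MvPolynomial.C ![A, B] q := fun q => rfl
  have hP0 : MvPolynomial.aeval ![A, B] (P 0) = A * (A + B) := by
    rw [hP0']
    simp only [map_mul, map_add, MvPolynomial.aeval_X, Matrix.cons_val_zero, Matrix.cons_val_one]
  have hP1 : MvPolynomial.aeval ![A, B] (P 1) = B * (A + B) := by
    rw [hP1']
    simp only [map_mul, map_add, MvPolynomial.aeval_X, Matrix.cons_val_zero, Matrix.cons_val_one]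
  have hP2 : MvPolynomial.aeval ![A, B] (P 2) = -(A ^ 2 - C (2 * Real.cos θ) * A * B + B ^ 2) := by
    rw [hP2']
    simp only [map_neg, map_add, map_sub, map_mul, map_pow, MvPolynomial.aeval_X, MvPolynomial.aeval_C,
      Matrix.cons_val_zero, Matrix.cons_val_one, MvPolynomial.algebraMap_eq]
  clear hAB
  have hUP : ∀ j, perPoly (Fin n) ℝ ∣ U j - MvPolynomial.aeval ![A, B] (P j) := by
    intro j
    fin_cases j
    · show perPoly (Fin n) ℝ ∣ U 0 - MvPolynomial.aeval ![A, B] (P 0)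
      rw [hU0, hP0, show A ^ 2 + A * B - A * (A + B) = 0 by ring]
      exact dvd_zero _
    · show perPoly (Fin n) ℝ ∣ U 1 - MvPolynomial.aeval ![A, B] (P 1)
      rw [hU1, hP1, show A * B + B ^ 2 - B * (A + B) = 0 by ring]
      exact dvd_zero _
    · show perPoly (Fin n) ℝ ∣ U 2 - MvPolynomial.aeval ![A, B] (P 2)
      rw [hU2, hP2]
      refine ⟨X a * X a * P' + X b * X b * P', ?_⟩
      rw [← hper, hA, hB]
      ring
  -- relations of the gates are the identities of the parametrisation
  have key : ∀ G : MvPolynomial (Fin 3) ℝ,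
      perPoly (Fin n) ℝ ∣ MvPolynomial.aeval U G ↔ MvPolynomial.aeval P G = 0 :=
    fun G => ParametrizedRelations.stub_parametrizedRelations n 3 A B hind P U hUP G
  have hcomm : ∀ G : MvPolynomial (Fin 3) ℝ≥0, MvPolynomial.aeval U (MvPolynomial.map NNReal.toRealHom G) =
      MvPolynomial.map NNReal.toRealHom (MvPolynomial.aeval u G) := by
    intro G
    rw [MvPolynomial.aeval_def, MvPolynomial.eval₂_map, MvPolynomial.map_aeval, MvPolynomial.coe_eval₂Hom]
    congr 1
    refine RingHom.ext fun x => ?_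
    simp only [RingHom.coe_comp, Function.comp_apply, MvPolynomial.algebraMap_eq, MvPolynomial.map_C]
  -- nonvanishing and degrees of the gates
  have hXa : (X a : MvPolynomial (Fin n × Fin n) ℝ≥0) ≠ 0 := X_ne_zero a
  have hXb : (X b : MvPolynomial (Fin n × Fin n) ℝ≥0) ≠ 0 := X_ne_zero b
  have hV₁0 : V₁ ≠ 0 := mul_ne_zero hXa hPp0
  have hV₂0 : V₂ ≠ 0 := mul_ne_zero hXb hPp0
  have hV₁'0 : V₁' ≠ 0 := mul_ne_zero hXa hPm0
  have hu0 : ∀ j, u j ≠ 0 := by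
    intro j
    fin_cases j
    · show u 0 ≠ 0
      rw [hu0']
      exact add_ne_zero_of_left_ne_zero _ (pow_ne_zero 2 hV₁0)
    · show u 1 ≠ 0
      rw [hu1']
      exact add_ne_zero_of_left_ne_zero _ (mul_ne_zero hV₁0 hV₂0)
    · show u 2 ≠ 0
      rw [hu2']
      exact add_ne_zero_of_left_ne_zero _ (add_ne_zero_of_left_ne_zero _ (mul_ne_zero hV₁0 hV₁'0))
  have hdegV : ∀ (v : Fin n × Fin n) (Q : MvPolynomial (Fin n × Fin n) ℝ≥0), Q.totalDegree = n →
      (X v * Q).totalDegree ≤ n + 1 := by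
    intro v Q hQ
    calc (X v * Q).totalDegree ≤ (X v : MvPolynomial (Fin n × Fin n) ℝ≥0).totalDegree + Q.totalDegree :=
          totalDegree_mul _ _
      _ = 1 + n := by rw [totalDegree_X, hQ]
      _ = n + 1 := Nat.add_comm _ _
  have hdV₁ : V₁.totalDegree ≤ n + 1 := hdegV a Pp hdegp
  have hdV₂ : V₂.totalDegree ≤ n + 1 := hdegV b Pp hdegp
  have hdV₁' : V₁'.totalDegree ≤ n + 1 := hdegV a Pm hdegm
  have hdV₂' : V₂'.totalDegree ≤ n + 1 := hdegV b Pm hdegm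
  have hdmul : ∀ {p q : MvPolynomial (Fin n × Fin n) ℝ≥0}, p.totalDegree ≤ n + 1 → q.totalDegree ≤ n + 1 →
      (p * q).totalDegree ≤ 2 * (n + 1) := fun hp hq =>
    (totalDegree_mul _ _).trans (by omega)
  have hdpow : ∀ {p : MvPolynomial (Fin n × Fin n) ℝ≥0}, p.totalDegree ≤ n + 1 →
      (p ^ 2).totalDegree ≤ 2 * (n + 1) := fun hp =>
    (totalDegree_pow _ _).trans (Nat.mul_le_mul_left 2 hp)
  have hdeg : ∀ j, (u j).totalDegree ≤ 2 * (n + 1) := by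
    intro j
    fin_cases j
    · show (u 0).totalDegree ≤ _
      rw [hu0']
      exact (totalDegree_add _ _).trans (max_le (hdpow hdV₁) (hdmul hdV₁ hdV₂))
    · show (u 1).totalDegree ≤ _
      rw [hu1']
      exact (totalDegree_add _ _).trans (max_le (hdmul hdV₁ hdV₂) (hdpow hdV₂))
    · show (u 2).totalDegree ≤ _
      rw [hu2']
      refine (totalDegree_add _ _).trans (max_le ((totalDegree_add _ _).trans (max_le (hdmul hdV₁ hdV₁') ?_))
        (hdmul hdV₂ hdV₂'))
      exact (totalDegree_smul_le _ _).trans (hdmul hdV₁ hdV₂)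
  refine ⟨u, hdeg, hu0, ?_, ?_⟩
  · -- (i) the cheap relation of degree 2^(k+1)
    obtain ⟨G, hG0, hGdeg, hGc, hGrel⟩ := ConicCheapRelation.stub_conicCheapRelation k
    refine ⟨G, hG0, hGdeg, hGc, aeval_ne_zero_of_ne_zero u hu0 G hG0, ?_⟩
    rw [← hcomm]
    exact (key _).mpr hGrel
  · -- (ii) every nonnegative relation has degree ≥ 2^k
    intro G hG0 hdvd
    rw [← hcomm] at hdvd
    have hrel := (key _).mp hdvd
    have hgap := ParametrizedConicGap.stub_parametrizedConicGap θ hθ hθπ (MvPolynomial.map NNReal.toRealHom G)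
      (Window.coeff_map_toRealHom_nonneg G)
      (fun h => hG0 (Window.map_toRealHom_injective (by rw [h, map_zero]))) hrel
    rw [Window.totalDegree_map_toRealHom] at hgap
    -- π/2 ≤ d · π/2^(k+1)  ⇒  2^k ≤ d
    have hreal : (2 : ℝ) ^ k ≤ (G.totalDegree : ℝ) := by
      rw [hθdef, pow_succ] at hgap
      have hπ := Real.pi_pos
      have hk : (0 : ℝ) < 2 ^ k := by positivity
      rw [mul_div_assoc', div_le_div_iff₀ (by norm_num) (by positivity)] at hgap
      nlinarith
    exact_mod_cast hreal

end Summit.ValiantsHypothesis.ValiantsHypothesis.Theorems.DivisionGap.PerCofactorDegreeReduction.GapCorollaries
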